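import Literature.Combinatorics.Designs.LegendrePairs

/-!
# The Goethals–Seidel array

[Goethals–Seidel, J. Austral. Math. Soc. 11 (1970) 343–344] (`GoethalsSeidel1970`): let `A, B, C, D` be circulant
matrices of order `v` over a commutative ring with `A Aᵀ + B Bᵀ + C Cᵀ + D Dᵀ = m·I`, and let `R` be the back-diagonal
permutation matrix (`R i j = [i + j = 0]`).  Then the array

  `GS = [[ A,   B R,   C R,   D R ],
         [-B R,  A,    Dᵀ R, -Cᵀ R],
         [-C R, -Dᵀ R,  A,    Bᵀ R],
         [-D R,  Cᵀ R, -Bᵀ R,  A  ]]`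

satisfies `GS · GSᵀ = m·I`.  With `±1` circulants of order `v` and `m = 4v` this is a Hadamard matrix of order `4v`
(`goethalsSeidel_isHadamard`); the hypothesis is the familiar condition on the first rows `a, b, c, d : ZMod v → ℤ`:
the periodic autocorrelations sum to `0` at every non-zero shift (`gram_of_paf`).  The Williamson array is the special
case of symmetric circulants.

Formalisation choices.  The index group is any finite additive commutative group `G` (so multi-circulant, "type 1",
blocks are covered); the blocks `X R` are written directly as back-circulant matrices `bcirc x i j = x (i + j)` and
`Xᵀ R` as `bcircT x = bcirc (x ∘ neg)`, so `R` itself never appears; the verification reduces to reindexing identities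
for products of (back-)circulants and the commutativity of circulants (Mathlib `Matrix.circulant_mul_comm`).  The array
is indexed by `Fin 4 × G`.  This is our formalisation of the published construction (cell pub-namedobj, target H: the
plug-in by which four sequences of length 167 would certify a Hadamard matrix of order 668).  No `sorry`, no new axioms.
-/

open Matrix BigOperators Finset

namespace Literature.Combinatorics.Designs.GoethalsSeidel

open Literature.Combinatorics.Designs.LegendrePairs (PAF IsPM paf_zero)

section General

variable {G : Type*} [AddCommGroup G] [Fintype G] [DecidableEq G] {α : Type*} [CommRing α]

/-- the transposed circulant, `circT x = circulant (x ∘ neg) = (circulant x)ᵀ`. [cite: GoethalsSeidel1970, the array] -/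
def circT (x : G → α) : Matrix G G α := circulant fun i => x (-i)

/-- back-circulant matrix of a sequence, `bcirc x i j = x (i + j)`; for the circulant `X` with first row `x` this is
`X R`, `R` the back-diagonal permutation matrix of the Goethals–Seidel array. [cite: GoethalsSeidel1970, the array] -/
def bcirc (x : G → α) : Matrix G G α := Matrix.of fun i j => x (i + j)

/-- `bcircT x = bcirc (x ∘ neg)`; for the circulant `X` with first row `x` this is `Xᵀ R`. [cite: GoethalsSeidel1970, the array] -/
def bcircT (x : G → α) : Matrix G G α := bcirc fun i => x (-i)

omit [Fintype G] [DecidableEq G] [CommRing α] in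
/-- entries of `bcirc`. [cite: GoethalsSeidel1970, the array (properties of R and of circulants used in the verification)] -/
@[simp] lemma bcirc_apply (x : G → α) (i j : G) : bcirc x i j = x (i + j) := rfl

omit [Fintype G] [DecidableEq G] [CommRing α] in
/-- entries of `bcircT`. [cite: GoethalsSeidel1970, the array (properties of R and of circulants used in the verification)] -/
@[simp] lemma bcircT_apply (x : G → α) (i j : G) : bcircT x i j = x (-(i + j)) := rfl

omit [Fintype G] [DecidableEq G] [CommRing α] in
/-- entries of `circT`. [cite: GoethalsSeidel1970, the array (properties of R and of circulants used in the verification)] -/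
@[simp] lemma circT_apply (x : G → α) (i j : G) : circT x i j = x (j - i) := by
  simp [circT, circulant_apply, neg_sub]

omit [Fintype G] [DecidableEq G] [CommRing α] in
/-- `(circulant x)ᵀ = circT x` (Mathlib `transpose_circulant`). [folklore] -/
@[simp] private lemma transpose_circulant' (x : G → α) : (circulant x)ᵀ = circT x := transpose_circulant x

omit [Fintype G] [DecidableEq G] [CommRing α] in
/-- `(circT x)ᵀ = circulant x`. [cite: GoethalsSeidel1970, the array (properties of R and of circulants used in the verification)] -/
@[simp] lemma transpose_circT (x : G → α) : (circT x)ᵀ = circulant x := by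
  rw [← transpose_circulant', transpose_transpose]

omit [Fintype G] [DecidableEq G] [CommRing α] in
/-- back-circulants are symmetric. [cite: GoethalsSeidel1970, the array (properties of R and of circulants used in the verification)] -/
@[simp] lemma transpose_bcirc (x : G → α) : (bcirc x)ᵀ = bcirc x := by
  ext i j; simp [add_comm]

omit [Fintype G] [DecidableEq G] [CommRing α] in
/-- `bcircT` is symmetric. [cite: GoethalsSeidel1970, the array (properties of R and of circulants used in the verification)] -/
@[simp] lemma transpose_bcircT (x : G → α) : (bcircT x)ᵀ = bcircT x := transpose_bcirc _

omit [DecidableEq G] in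
/-- `(X R)(Y R)ᵀ = X Yᵀ`: `bcirc x * bcirc y = circulant x * circT y`. [cite: GoethalsSeidel1970, the array (properties of R and of circulants used in the verification)] -/
@[simp] lemma bcirc_mul_bcirc (x y : G → α) : bcirc x * bcirc y = circulant x * circT y := by
  ext i k
  simp only [mul_apply, bcirc_apply, circulant_apply, circT_apply]
  refine Fintype.sum_equiv (Equiv.neg G) _ _ (fun j => ?_)
  simp only [Equiv.neg_apply]
  congr 1 <;> (congr 1; abel)

omit [DecidableEq G] in
/-- `(X R)(Yᵀ R)ᵀ = X Y`. [cite: GoethalsSeidel1970, the array (properties of R and of circulants used in the verification)] -/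
@[simp] lemma bcirc_mul_bcircT (x y : G → α) : bcirc x * bcircT y = circulant x * circulant y := by
  rw [bcircT, bcirc_mul_bcirc]
  simp only [circT, neg_neg]

omit [DecidableEq G] in
/-- `(Xᵀ R)(Y R)ᵀ = Xᵀ Yᵀ`. [cite: GoethalsSeidel1970, the array (properties of R and of circulants used in the verification)] -/
@[simp] lemma bcircT_mul_bcirc (x y : G → α) : bcircT x * bcirc y = circT x * circT y := by
  rw [bcircT, bcirc_mul_bcirc]; rfl

omit [DecidableEq G] in
/-- `(Xᵀ R)(Yᵀ R)ᵀ = Xᵀ Y`. [cite: GoethalsSeidel1970, the array (properties of R and of circulants used in the verification)] -/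
@[simp] lemma bcircT_mul_bcircT (x y : G → α) : bcircT x * bcircT y = circT x * circulant y := by
  rw [bcircT, bcircT, bcirc_mul_bcirc]
  simp only [circT, neg_neg]

omit [DecidableEq G] in
/-- `(X R) Aᵀ = A (X R)`: `bcirc x * circT a = circulant a * bcirc x`. [cite: GoethalsSeidel1970, the array (properties of R and of circulants used in the verification)] -/
@[simp] lemma bcirc_mul_circT (a x : G → α) : bcirc x * circT a = circulant a * bcirc x := by
  ext i k
  simp only [mul_apply, bcirc_apply, circulant_apply, circT_apply]
  symm
  refine Fintype.sum_equiv (Equiv.addRight (k - i)) _ _ (fun j => ?_)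
  simp only [Equiv.coe_addRight]
  rw [mul_comm]
  congr 1 <;> (congr 1; abel)

omit [DecidableEq G] in
/-- `(Xᵀ R) Aᵀ = A (Xᵀ R)`. [cite: GoethalsSeidel1970, the array (properties of R and of circulants used in the verification)] -/
@[simp] lemma bcircT_mul_circT (a x : G → α) : bcircT x * circT a = circulant a * bcircT x := by
  rw [bcircT, bcirc_mul_circT]

omit [DecidableEq G] in
/-- circulants commute (Mathlib), oriented: a transposed circulant moves to the right. [cite: GoethalsSeidel1970, the array (properties of R and of circulants used in the verification)] -/
@[simp] lemma circT_mul_circulant (x y : G → α) : circT x * circulant y = circulant y * circT x := by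
  rw [circT, circulant_mul_comm]

omit [DecidableEq G] in
/-- circulants commute (Mathlib); instance form used to orient products below. [folklore] -/
private lemma cc (x y : G → α) : circulant x * circulant y = circulant y * circulant x := circulant_mul_comm x y

omit [DecidableEq G] in
/-- transposed circulants commute; instance form used to orient products below. [folklore] -/
private lemma ccT (x y : G → α) : circT x * circT y = circT y * circT x := by
  rw [circT, circT, circulant_mul_comm]

/-- the sixteen blocks of the Goethals–Seidel array on first rows `a, b, c, d` (`A = circulant a`, `X R = bcirc x`,
`Xᵀ R = bcircT x`). [cite: GoethalsSeidel1970, the array] -/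
def gsBlocks (a b c d : G → α) : Fin 4 → Fin 4 → Matrix G G α :=
  ![![circulant a, bcirc b, bcirc c, bcirc d],
    ![-bcirc b, circulant a, bcircT d, -bcircT c],
    ![-bcirc c, -bcircT d, circulant a, bcircT b],
    ![-bcirc d, bcircT c, -bcircT b, circulant a]]

/-- the Goethals–Seidel array as a matrix indexed by `Fin 4 × G`. [cite: GoethalsSeidel1970, the array] -/
def gsMatrix (a b c d : G → α) : Matrix (Fin 4 × G) (Fin 4 × G) α :=
  Matrix.of fun p q => gsBlocks a b c d p.1 q.1 p.2 q.2

/-- the Gram sum `A Aᵀ + B Bᵀ + C Cᵀ + D Dᵀ` of the four circulants. [cite: GoethalsSeidel1970, the array (hypothesis)] -/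
def gram (a b c d : G → α) : Matrix G G α :=
  circulant a * circT a + circulant b * circT b + circulant c * circT c + circulant d * circT d

omit [DecidableEq G] in
/-- block form of `GS · GSᵀ`. [folklore] -/
private lemma gsMatrix_mul_transpose_apply (a b c d : G → α) (p r : Fin 4) (i k : G) :
    (gsMatrix a b c d * (gsMatrix a b c d)ᵀ) (p, i) (r, k) =
      (∑ q, gsBlocks a b c d p q * (gsBlocks a b c d r q)ᵀ) i k := by
  simp only [gsMatrix, mul_apply, transpose_apply, of_apply, Fintype.sum_prod_type, Matrix.sum_apply]

omit [DecidableEq G] in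
/-- **the Goethals–Seidel block identities**: `Σ_q GS_{pq} GS_{rq}ᵀ = [p = r] · (A Aᵀ + B Bᵀ + C Cᵀ + D Dᵀ)`.
[cite: GoethalsSeidel1970, the array] -/
theorem gs_block_identity (a b c d : G → α) (p r : Fin 4) :
    ∑ q, gsBlocks a b c d p q * (gsBlocks a b c d r q)ᵀ = if p = r then gram a b c d else 0 := by
  fin_cases p <;> fin_cases r <;>
    simp [gsBlocks, gram, Fin.sum_univ_four, Matrix.transpose_neg,
      cc c b, cc d b, cc d c, ccT c b, ccT d b, ccT d c] <;>
    abel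

/-- **Goethals–Seidel.** If `A Aᵀ + B Bᵀ + C Cᵀ + D Dᵀ = m·I` for circulants `A, B, C, D` over a finite abelian group,
then the Goethals–Seidel array satisfies `GS · GSᵀ = m·I`. [cite: GoethalsSeidel1970, the array] -/
theorem gsMatrix_mul_transpose (a b c d : G → α) (m : α) (h : gram a b c d = m • (1 : Matrix G G α)) :
    gsMatrix a b c d * (gsMatrix a b c d)ᵀ = m • (1 : Matrix (Fin 4 × G) (Fin 4 × G) α) := by
  ext ⟨p, i⟩ ⟨r, k⟩
  rw [gsMatrix_mul_transpose_apply, gs_block_identity]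
  by_cases hpr : p = r
  · subst hpr
    simp [h, Matrix.one_apply]
  · have : (p, i) ≠ (r, k) := fun e => hpr (Prod.mk.inj e).1
    simp [hpr, this]

end General

/-! ## First rows, periodic autocorrelation, and the Hadamard conclusion -/

section PAF

variable {n : ℕ} [NeZero n]

/-- entries of `X Xᵀ` for a circulant are periodic autocorrelations of the first row:
`(circulant x · circT x) i k = PAF_x (k - i)`. [cite: GoethalsSeidel1970, the array (first-row form of the hypothesis)] -/
lemma circulant_mul_circT_apply (x : ZMod n → ℤ) (i k : ZMod n) :
    (circulant x * circT x) i k = PAF x (k - i) := by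
  simp only [mul_apply, circulant_apply, circT_apply, PAF]
  refine Fintype.sum_equiv (Equiv.subLeft i) _ _ (fun j => ?_)
  simp only [Equiv.subLeft_apply]
  congr 1; congr 1; abel

/-- the first-row form of the hypothesis: for `±1` sequences whose periodic autocorrelations sum to `0` at every
non-zero shift, `A Aᵀ + B Bᵀ + C Cᵀ + D Dᵀ = 4n·I`. [cite: GoethalsSeidel1970, the array] -/
theorem gram_of_paf (a b c d : ZMod n → ℤ) (ha : IsPM a) (hb : IsPM b) (hc : IsPM c) (hd : IsPM d)
    (hs : ∀ s : ZMod n, s ≠ 0 → PAF a s + PAF b s + PAF c s + PAF d s = 0) :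
    gram a b c d = (4 * n : ℤ) • (1 : Matrix (ZMod n) (ZMod n) ℤ) := by
  ext i k
  rw [gram, Matrix.add_apply, Matrix.add_apply, Matrix.add_apply, circulant_mul_circT_apply,
    circulant_mul_circT_apply, circulant_mul_circT_apply, circulant_mul_circT_apply, Matrix.smul_apply,
    Matrix.one_apply, smul_eq_mul]
  by_cases hik : i = k
  · subst hik
    rw [sub_self, paf_zero a ha, paf_zero b hb, paf_zero c hc, paf_zero d hd, if_pos rfl]
    ring
  · have hki : k - i ≠ 0 := sub_ne_zero.mpr (Ne.symm hik)
    rw [hs _ hki, if_neg hik, mul_zero]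

/-- a Hadamard matrix: entries `±1` and `H Hᵀ = N·I`, `N` the order. [cite: GoethalsSeidel1970, §1 (definition)] -/
def IsHadamardMatrix {ι : Type*} [Fintype ι] [DecidableEq ι] (H : Matrix ι ι ℤ) : Prop :=
  (∀ i j, H i j = 1 ∨ H i j = -1) ∧ H * Hᵀ = (Fintype.card ι : ℤ) • (1 : Matrix ι ι ℤ)

omit [NeZero n] in
/-- a negated `±1` value is `±1`. [folklore] -/
private lemma neg_pm {x : ZMod n → ℤ} (hx : IsPM x) (t : ZMod n) : -x t = 1 ∨ -x t = -1 := by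
  rcases hx t with h | h
  · right; rw [h]
  · left; rw [h]; norm_num

omit [NeZero n] in
/-- the entries of the Goethals–Seidel array are `±1` when the first rows are. [cite: GoethalsSeidel1970, the array] -/
lemma gsMatrix_pm (a b c d : ZMod n → ℤ) (ha : IsPM a) (hb : IsPM b) (hc : IsPM c) (hd : IsPM d)
    (P Q : Fin 4 × ZMod n) : gsMatrix a b c d P Q = 1 ∨ gsMatrix a b c d P Q = -1 := by
  obtain ⟨p, i⟩ := P
  obtain ⟨q, j⟩ := Q
  simp only [gsMatrix, of_apply]
  fin_cases p <;> fin_cases q <;>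
    simp only [gsBlocks, Fin.zero_eta, Fin.mk_one, Fin.isValue, Matrix.cons_val_zero, Matrix.cons_val_one,
      Matrix.neg_apply, bcirc_apply, circulant_apply] <;>
    first
      | exact ha _ | exact hb _ | exact hc _ | exact hd _
      | exact neg_pm ha _ | exact neg_pm hb _ | exact neg_pm hc _ | exact neg_pm hd _

/-- **Goethals–Seidel (Hadamard form).** Four `±1` sequences `a, b, c, d` on `ZMod n` with
`PAF_a(s) + PAF_b(s) + PAF_c(s) + PAF_d(s) = 0` for all `s ≠ 0` give, through the Goethals–Seidel array, a Hadamard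
matrix of order `4n`. [cite: GoethalsSeidel1970, the array] -/
theorem goethalsSeidel_isHadamard (a b c d : ZMod n → ℤ) (ha : IsPM a) (hb : IsPM b) (hc : IsPM c) (hd : IsPM d)
    (hs : ∀ s : ZMod n, s ≠ 0 → PAF a s + PAF b s + PAF c s + PAF d s = 0) :
    IsHadamardMatrix (gsMatrix a b c d) := by
  refine ⟨gsMatrix_pm a b c d ha hb hc hd, ?_⟩
  have hcard : (Fintype.card (Fin 4 × ZMod n) : ℤ) = 4 * n := by
    simp [Fintype.card_prod, ZMod.card]
  rw [hcard]
  exact gsMatrix_mul_transpose a b c d _ (gram_of_paf a b c d ha hb hc hd hs)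

end PAF

end Literature.Combinatorics.Designs.GoethalsSeidel
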